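import Literature.NumberTheory.GaloisRepresentations.DiscreteCochainsLongExact
import Literature.NumberTheory.GaloisRepresentations.ContinuousCohomologyNineTerm
import Literature.NumberTheory.GaloisRepresentations.CohomologicalDimension
import Literature.NumberTheory.EllipticCurves.ZpCorankQuasiIso
import HarnessLib

/-!
# The `H²` bookkeeping of the V21 index road, over an arbitrary compact group (cell `bsd-eis`, seat
# `bsd-line-x1-p1-w4` gen 4; crux 2 `GoodLatticeBDPValue` stmt-BirchSwinnertonDyer-19032, line `halves`, road step (6))

HONEST FRAMING (cell `bsd-eis`, run/shared/lean/pub/bsd-eis/): generic continuous cohomology of a compact topological group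
with discrete coefficients (no definition, no named fact, no `sorry`, no `Theses` import); nothing about any curve is asserted;
BSD / IMC2 / KY Thm. 1.4.1 are proved for NO curve. Helper `--supports stmt-BirchSwinnertonDyer-19032`; closes no registered stub.

## What

LEAD g4's abstract assembly `FiniteIndexCalculus.zpCorank_add_eq_of_index_inputs` (file
`…EisensteinPrimesLambdaIdentityOfIndexInputs`, road memo `Cruxes/GoodLatticeBDPValue/Lines/halves-imprimLambda-index-road.md`
§2 (6) / §4 S4) takes as its LAST input the `H²` bookkeeping
`#coker(H¹(G,N_f) → H¹(G,N_1)) · #(U_f/p) = #(U_ω/p) · #(U_1/p)`, `U_? = H¹(G, A_?)`, `N_? = A_?[p]`, `G = Gal(K_Σ/K_∞)`.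
This file proves that identity for an ARBITRARY compact topological group `Γ` and discrete `Γ`-modules, from the long exact
cohomology sequence in all degrees (tree `IsSES.exists_connectingHom`, `DiscreteCochainsLongExact.lean`; counting via the tree's
`natCard_eq_card_ker_mul_card_range`, `card_range_of_surjective'`):

* §1 `natCard_coker_one_mul_natCard_two` — along `0 → M₁ → M₂ → M₃ → 0` with `H³(Γ, M₁) = 0`:
  **`#coker(H¹(Γ,M₂) → H¹(Γ,M₃)) · #H²(Γ,M₂) = #H²(Γ,M₁) · #H²(Γ,M₃)`** (exactness of
  `H¹(M₂) → H¹(M₃) → H²(M₁) → H²(M₂) → H²(M₃) → H³(M₁) = 0`); all cardinals are `Nat.card` and the identity holds with no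
  finiteness hypothesis (an infinite group counts `0` on both sides).
* §2 `natCard_modN_one_mul_natCard_torsionBy_two` — LEVEL-2 KUMMER: along `0 → N →i M →p M → 0` (`i(N) = M[p]`, `M`
  `p`-divisible): **`#(H¹(Γ,M)/p) · #H²(Γ,M)[p] = #H²(Γ,N)`** (`cohomologyMap (p • 𝟙) = p • 𝟙` in degrees `1`, `2`).
* §3 `natCard_H2bookkeeping` — the road's shape: three Kummer pairs `N_? ⊂ A_?` (`? = ω, f, 1`), a residual short exact sequence
  `0 → N_ω → N_f → N_1 → 0`, `H²(Γ, A_?) = 0` (weak-Leopoldt-type vanishing, HYPOTHESES) and `H³(Γ, N_ω) = 0` give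
  **`#coker(H¹(Γ,N_f) → H¹(Γ,N_1)) · #(H¹(Γ,A_f)/p) = #(H¹(Γ,A_ω)/p) · #(H¹(Γ,A_1)/p)`**; `natCard_H2bookkeeping_of_groupCdLE`
  derives `H³(Γ, N_ω) = 0` from `cd_p(Γ) ≤ 2` (`GroupCdLE Γ p 2`, the tree's currency; for `Γ = Gal(K_Σ/K_∞)` this is the typed
  PUB fact `DiscreteGaloisModule.groupCdLE_two_galoisGroupUnramifiedOutside` + `groupCdLE_subgroup_of_isClosed_holds`).

The transport to the LEAD's `unramifiedOutside (ker κ)`-currency (inflation `H¹(Gal(K_Σ/K_∞), M) ≅ unramifiedOutside`) is the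
next file of this seat.

References: [SerreGaloisCohomology1997] I §2.2 (cohomology sequence), I §3.1 Prop. 11 (`cd_p`); [NeukirchSchmidtWingberg2008]
(1.3.2), (8.3.18); [KellerYin2024] §1.4 (arXiv:2402.12781v2, proof of Thm. 1.4.1 (iii): the groups `K^{(2)}_?`); the road memo §2 (6).
-/

set_option autoImplicit false
set_option linter.dupNamespace false -- the summit namespace `…BirchSwinnertonDyer.BirchSwinnertonDyer.Theorems` (Sub = Summit, D-0017) trips it

noncomputable section

universe u

namespace Summit.BirchSwinnertonDyer.BirchSwinnertonDyer.Theorems.H2Bookkeeping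

open CategoryTheory Function ContinuousCohomology
open Literature.NumberTheory.GaloisRepresentations Literature.NumberTheory.EllipticCurves

/-! ## §0 Counting helpers -/

section Counting

/-- `#im φ = #(X ⧸ S)` when `ker φ = S`. [folklore] -/
theorem natCard_range_eq_quotient {X Y : Type*} [AddCommGroup X] [AddCommGroup Y] (φ : X →+ Y)
    {S : AddSubgroup X} (hS : φ.ker = S) : Nat.card φ.range = Nat.card (X ⧸ S) := by
  rw [← Nat.card_congr (QuotientAddGroup.quotientKerEquivRange φ).toEquiv]
  exact Nat.card_congr (QuotientAddGroup.quotientAddEquivOfEq hS).toEquiv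

/-- `#(X ⧸ S) = #(X/pX)` when `S = pX` (Mathlib's `ModN X p = X ⧸ range (lsmul ℤ X p)`). [folklore] -/
theorem natCard_quotient_eq_natCard_modN {X : Type*} [AddCommGroup X] (p : ℕ) (S : AddSubgroup X)
    (hS : ∀ x, x ∈ S ↔ ∃ b : X, p • b = x) : Nat.card (X ⧸ S) = Nat.card (ModN X p) := by
  have h : S = (LinearMap.range (LinearMap.lsmul ℤ X p)).toAddSubgroup := by
    ext x
    rw [hS, Submodule.mem_toAddSubgroup, LinearMap.mem_range]
    simp only [LinearMap.lsmul_apply, Nat.cast_smul_eq_nsmul]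
  rw [h]
  rfl

end Counting

section Cohomology

variable {Γ : Type u} [Group Γ] [TopologicalSpace Γ] [IsTopologicalGroup Γ] [CompactSpace Γ]
variable {M₁ : Type u} [AddCommGroup M₁] [TopologicalSpace M₁] [DiscreteTopology M₁]
variable {M₂ : Type u} [AddCommGroup M₂] [TopologicalSpace M₂] [DiscreteTopology M₂]
variable {M₃ : Type u} [AddCommGroup M₃] [TopologicalSpace M₃] [DiscreteTopology M₃]
variable {ρ₁ : ContinuousRep Γ ℤ M₁} {ρ₂ : ContinuousRep Γ ℤ M₂} {ρ₃ : ContinuousRep Γ ℤ M₃}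

/-! ## §1 `#coker(H¹(M₂) → H¹(M₃)) · #H²(M₂) = #H²(M₁) · #H²(M₃)` when `H³(M₁) = 0` -/

/-- **The `H²` count along a short exact sequence.** For `0 → M₁ —f→ M₂ —g→ M₃ → 0` of discrete modules over a compact group
`Γ` with `H³(Γ, M₁) = 0`: `#coker(H¹(g)) · #H²(Γ, M₂) = #H²(Γ, M₁) · #H²(Γ, M₃)` (`Nat.card`; exactness of
`H¹(M₂) → H¹(M₃) →δ H²(M₁) → H²(M₂) → H²(M₃) → H³(M₁) = 0`: `#H²(M₂) = #im H²(f) · #H²(M₃)`,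
`#H²(M₁) = #im δ · #im H²(f)`, `im δ ≅ coker H¹(g)`). [cite: SerreGaloisCohomology1997, I §2.2] [cite: NeukirchSchmidtWingberg2008, (1.3.2)] -/
theorem natCard_coker_one_mul_natCard_two {f : ρ₁.toTopRep ⟶ ρ₂.toTopRep} {g : ρ₂.toTopRep ⟶ ρ₃.toTopRep}
    (h : IsSES f g) [Subsingleton (continuousCohomology 3 ρ₁.toTopRep)] :
    Nat.card (continuousCohomology 1 ρ₃.toTopRep ⧸ (cohomologyMap g 1).hom.toLinearMap.toAddMonoidHom.range) *
        Nat.card (continuousCohomology 2 ρ₂.toTopRep) =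
      Nat.card (continuousCohomology 2 ρ₁.toTopRep) * Nat.card (continuousCohomology 2 ρ₃.toTopRep) := by
  obtain ⟨δ, hδ₁, hδ₂, hδ₃, hδ₄⟩ := h.exists_connectingHom 1
  set q₁ : continuousCohomology 1 ρ₂.toTopRep →+ continuousCohomology 1 ρ₃.toTopRep :=
    (cohomologyMap g 1).hom.toLinearMap.toAddMonoidHom with hq₁
  set j₂ : continuousCohomology 2 ρ₁.toTopRep →+ continuousCohomology 2 ρ₂.toTopRep :=
    (cohomologyMap f 2).hom.toLinearMap.toAddMonoidHom with hj₂
  set q₂ : continuousCohomology 2 ρ₂.toTopRep →+ continuousCohomology 2 ρ₃.toTopRep :=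
    (cohomologyMap g 2).hom.toLinearMap.toAddMonoidHom with hq₂
  set δ' : continuousCohomology 1 ρ₃.toTopRep →+ continuousCohomology 2 ρ₁.toTopRep := δ.toAddMonoidHom with hδ'
  -- exactness, as equalities of subgroups
  have hker_j₂ : j₂.ker = δ'.range := by
    ext c
    constructor
    · intro hc
      obtain ⟨γ, hγ⟩ := hδ₁ c ((AddMonoidHom.mem_ker).1 hc)
      exact ⟨γ, hγ⟩
    · rintro ⟨γ, rfl⟩
      exact (AddMonoidHom.mem_ker).2 (hδ₄ γ)
  have hker_δ : δ'.ker = q₁.range := by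
    ext γ
    constructor
    · intro hγ
      obtain ⟨b, hb⟩ := hδ₂ γ ((AddMonoidHom.mem_ker).1 hγ)
      exact ⟨b, hb⟩
    · rintro ⟨b, rfl⟩
      exact (AddMonoidHom.mem_ker).2 (hδ₃ b)
  have hker_q₂ : q₂.ker = j₂.range := by
    ext c
    constructor
    · intro hc
      obtain ⟨a, ha⟩ := h.exists_cohomologyMap_eq_of_cohomologyMap_eq_zero 2 c ((AddMonoidHom.mem_ker).1 hc)
      exact ⟨a, ha⟩
    · rintro ⟨a, rfl⟩
      exact (AddMonoidHom.mem_ker).2 (h.cohomologyMap_comp_apply_eq_zero' 2 a)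
  have hsurj_q₂ : Surjective q₂ := h.map_two_surjective_of_subsingleton_three
  -- counts
  have c₂ : Nat.card (continuousCohomology 2 ρ₂.toTopRep) = Nat.card j₂.range * Nat.card (continuousCohomology 2 ρ₃.toTopRep) := by
    rw [natCard_eq_card_ker_mul_card_range q₂, hker_q₂, card_range_of_surjective' q₂ hsurj_q₂]
  have c₁ : Nat.card (continuousCohomology 2 ρ₁.toTopRep) = Nat.card δ'.range * Nat.card j₂.range := by
    rw [natCard_eq_card_ker_mul_card_range j₂, hker_j₂]
  have cδ : Nat.card δ'.range = Nat.card (continuousCohomology 1 ρ₃.toTopRep ⧸ q₁.range) :=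
    natCard_range_eq_quotient δ' hker_δ
  rw [c₂, c₁, cδ]
  ring

/-! ## §2 Level-2 Kummer: `#(H¹(M)/p) · #H²(M)[p] = #H²(N)` -/

omit [CompactSpace Γ] in
/-- `H¹(p • 𝟙) = p • 𝟙` on `H¹(Γ, M)`, for an endomorphism acting as multiplication by `p`. [folklore] -/
theorem cohomologyMap_one_eq_nsmul (e : ρ₂.toTopRep ⟶ ρ₂.toTopRep) {p : ℕ} (he : ∀ m : M₂, e.hom m = p • m)
    (x : continuousCohomology 1 ρ₂.toTopRep) : cohomologyMap e 1 x = p • x := by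
  obtain ⟨φ, rfl⟩ := oneCocycleClass_surjective _ x
  rw [cohomologyMap_oneCocycleClass]
  have hφ : contOneCocycles.pullback (ContinuousMonoidHom.id Γ) (resIdHom e) φ = (p : ℤ) • φ :=
    Subtype.ext (ContinuousMap.ext fun σ ↦ by
      rw [pullback_id_resIdHom_apply, he]
      change p • φ.1 σ = (p : ℤ) • φ.1 σ
      rw [natCast_zsmul])
  rw [hφ, oneCocycleClass_smul, Nat.cast_smul_eq_nsmul]

omit [CompactSpace Γ] in
/-- `H²(p • 𝟙) = p • 𝟙` on `H²(Γ, M)` (locally compact `Γ`). [folklore] -/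
theorem cohomologyMap_two_eq_nsmul [LocallyCompactSpace Γ] (e : ρ₂.toTopRep ⟶ ρ₂.toTopRep) {p : ℕ}
    (he : ∀ m : M₂, e.hom m = p • m) (x : continuousCohomology 2 ρ₂.toTopRep) : cohomologyMap e 2 x = p • x := by
  obtain ⟨c, rfl⟩ := twoCocycleClass_surjective _ x
  rw [cohomologyMap_twoCocycleClass]
  have hc : contTwoCocycles.pullback (ContinuousMonoidHom.id Γ) (resIdHom e) c = (p : ℤ) • c :=
    Subtype.ext (ContinuousMap.ext fun q ↦ by
      obtain ⟨σ, s⟩ := q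
      rw [pullback₂_id_resIdHom_apply, he]
      change p • c.1 (σ, s) = (p : ℤ) • c.1 (σ, s)
      rw [natCast_zsmul])
  rw [hc, twoCocycleClass_smul, Nat.cast_smul_eq_nsmul]

/-- **Level-2 Kummer count.** For `0 → N —i→ M —p→ M → 0` (discrete modules over a compact group: `i` injective with image
`M[p]`, `M` `p`-divisible): `#(H¹(Γ,M)/pH¹(Γ,M)) · #H²(Γ,M)[p] = #H²(Γ,N)` (`Nat.card`; the cohomology sequence
`H¹(M) →p H¹(M) →δ H²(N) → H²(M) →p H²(M)` gives `0 → H¹(M)/p → H²(N) → H²(M)[p] → 0`).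
[cite: SerreGaloisCohomology1997, I §2.2] [cite: NeukirchSchmidtWingberg2008, (1.3.2)] -/
theorem natCard_modN_one_mul_natCard_torsionBy_two [LocallyCompactSpace Γ] (i : ρ₁.toTopRep ⟶ ρ₂.toTopRep) {p : ℕ}
    (hinj : Injective i.hom) (htors : ∀ n : M₁, p • i.hom n = 0) (hexact : ∀ m : M₂, p • m = 0 → ∃ n : M₁, i.hom n = m)
    (hdiv : ∀ m : M₂, ∃ m' : M₂, p • m' = m) :
    Nat.card (ModN (continuousCohomology 1 ρ₂.toTopRep) p) *
        Nat.card (AddSubgroup.torsionBy (continuousCohomology 2 ρ₂.toTopRep) (p : ℤ)) =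
      Nat.card (continuousCohomology 2 ρ₁.toTopRep) := by
  -- multiplication by `p` as an endomorphism of the discrete module
  let e : ρ₂.toTopRep ⟶ ρ₂.toTopRep :=
    TopRep.ofHom
      { toLinearMap := (p : ℤ) • LinearMap.id
        cont := continuous_of_discreteTopology
        isIntertwining' := fun σ ↦ by
          ext a
          change (p : ℤ) • (ρ₂ σ a) = ρ₂ σ ((p : ℤ) • a)
          rw [map_zsmul] }
  have he : ∀ m : M₂, e.hom m = p • m := fun m ↦ by
    change (p : ℤ) • m = p • m
    rw [natCast_zsmul]
  have hSES : IsSES i e :=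
    { comp_eq_zero := by
        ext n
        change e.hom (i.hom n) = 0
        rw [he]; exact htors n
      injective := hinj
      exact_mid := fun m hm ↦ hexact m (by rw [← he]; exact hm)
      surjective := fun m ↦ by
        obtain ⟨m', hm'⟩ := hdiv m
        exact ⟨m', by rw [he, hm']⟩ }
  obtain ⟨δ, hδ₁, hδ₂, hδ₃, hδ₄⟩ := hSES.exists_connectingHom 1
  set i₂ : continuousCohomology 2 ρ₁.toTopRep →+ continuousCohomology 2 ρ₂.toTopRep :=
    (cohomologyMap i 2).hom.toLinearMap.toAddMonoidHom with hi₂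
  set δ' : continuousCohomology 1 ρ₂.toTopRep →+ continuousCohomology 2 ρ₁.toTopRep := δ.toAddMonoidHom with hδ'
  have hker_i₂ : i₂.ker = δ'.range := by
    ext c
    constructor
    · intro hc
      obtain ⟨γ, hγ⟩ := hδ₁ c ((AddMonoidHom.mem_ker).1 hc)
      exact ⟨γ, hγ⟩
    · rintro ⟨γ, rfl⟩
      exact (AddMonoidHom.mem_ker).2 (hδ₄ γ)
  -- `ker δ = p · H¹(M)`
  have hker_δ : ∀ γ, γ ∈ δ'.ker ↔ ∃ b : continuousCohomology 1 ρ₂.toTopRep, p • b = γ := by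
    intro γ
    rw [AddMonoidHom.mem_ker]
    constructor
    · intro hγ
      obtain ⟨b, hb⟩ := hδ₂ γ hγ
      exact ⟨b, by rw [← hb]; exact (cohomologyMap_one_eq_nsmul e he b).symm⟩
    · rintro ⟨b, rfl⟩
      have h0 := hδ₃ b
      rw [cohomologyMap_one_eq_nsmul e he b] at h0
      exact h0
  -- `im H²(i) = H²(M)[p]`
  have hrange_i₂ : i₂.range = AddSubgroup.torsionBy (continuousCohomology 2 ρ₂.toTopRep) (p : ℤ) := by
    ext c
    rw [AddSubgroup.torsionBy.nsmul_iff]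
    constructor
    · rintro ⟨a, rfl⟩
      have h0 := hSES.cohomologyMap_comp_apply_eq_zero' 2 a
      rw [cohomologyMap_two_eq_nsmul e he] at h0
      exact h0
    · intro hc
      obtain ⟨a, ha⟩ := hSES.exists_cohomologyMap_eq_of_cohomologyMap_eq_zero 2 c
        (by rw [cohomologyMap_two_eq_nsmul e he]; exact hc)
      exact ⟨a, ha⟩
  rw [natCard_eq_card_ker_mul_card_range i₂, hker_i₂, hrange_i₂, natCard_range_eq_quotient δ' rfl,
    natCard_quotient_eq_natCard_modN p δ'.ker hker_δ]

/-! ## §3 The road's shape: three Kummer pairs, one residual sequence, weak Leopoldt, `cd_p ≤ 2` -/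

variable {A₁ : Type u} [AddCommGroup A₁] [TopologicalSpace A₁] [DiscreteTopology A₁]
variable {A₂ : Type u} [AddCommGroup A₂] [TopologicalSpace A₂] [DiscreteTopology A₂]
variable {A₃ : Type u} [AddCommGroup A₃] [TopologicalSpace A₃] [DiscreteTopology A₃]
variable {τ₁ : ContinuousRep Γ ℤ A₁} {τ₂ : ContinuousRep Γ ℤ A₂} {τ₃ : ContinuousRep Γ ℤ A₃}

/-- Under `H²(Γ, M) = 0`, the level-2 Kummer count reads `#(H¹(Γ,M)/p) = #H²(Γ,N)`. [cite: SerreGaloisCohomology1997, I §2.2] -/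
theorem natCard_modN_one_eq_natCard_two [LocallyCompactSpace Γ] (i : ρ₁.toTopRep ⟶ ρ₂.toTopRep) {p : ℕ}
    (hinj : Injective i.hom) (htors : ∀ n : M₁, p • i.hom n = 0) (hexact : ∀ m : M₂, p • m = 0 → ∃ n : M₁, i.hom n = m)
    (hdiv : ∀ m : M₂, ∃ m' : M₂, p • m' = m) [Subsingleton (continuousCohomology 2 ρ₂.toTopRep)] :
    Nat.card (ModN (continuousCohomology 1 ρ₂.toTopRep) p) = Nat.card (continuousCohomology 2 ρ₁.toTopRep) := by
  have h := natCard_modN_one_mul_natCard_torsionBy_two i hinj htors hexact hdiv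
  have h1 : Nat.card (AddSubgroup.torsionBy (continuousCohomology 2 ρ₂.toTopRep) (p : ℤ)) = 1 :=
    Nat.card_of_subsingleton 0
  rwa [h1, mul_one] at h

/-- **The `H²` bookkeeping of the V21 road (memo §2 (6)), over an arbitrary compact group.** Data: a residual short exact
sequence `0 → N_ω —f→ N_f —g→ N_1 → 0` of discrete `Γ`-modules; Kummer pairs `i_? : N_? ↪ A_?` with `i_?(N_?) = A_?[p]` and `A_?`
`p`-divisible (`? = ω, f, 1`); `H²(Γ, A_?) = 0` (three weak-Leopoldt-type hypotheses) and `H³(Γ, N_ω) = 0`. THEN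
`#coker(H¹(Γ,N_f) → H¹(Γ,N_1)) · #(H¹(Γ,A_f)/p) = #(H¹(Γ,A_ω)/p) · #(H¹(Γ,A_1)/p)` — the hypothesis `hH2` of
`FiniteIndexCalculus.zpCorank_add_eq_of_index_inputs` with `X_? = H¹(Γ, N_?)`, `U_? = H¹(Γ, A_?)`.
[cite: KellerYin2024, §1.4 (proof of Thm. 1.4.1 (iii))] [cite: SerreGaloisCohomology1997, I §2.2] -/
theorem natCard_H2bookkeeping [LocallyCompactSpace Γ] {f : ρ₁.toTopRep ⟶ ρ₂.toTopRep} {g : ρ₂.toTopRep ⟶ ρ₃.toTopRep}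
    (h : IsSES f g) {p : ℕ} (i₁ : ρ₁.toTopRep ⟶ τ₁.toTopRep) (i₂ : ρ₂.toTopRep ⟶ τ₂.toTopRep) (i₃ : ρ₃.toTopRep ⟶ τ₃.toTopRep)
    (hinj₁ : Injective i₁.hom) (htors₁ : ∀ n : M₁, p • i₁.hom n = 0) (hexact₁ : ∀ m : A₁, p • m = 0 → ∃ n : M₁, i₁.hom n = m)
    (hdiv₁ : ∀ m : A₁, ∃ m' : A₁, p • m' = m)
    (hinj₂ : Injective i₂.hom) (htors₂ : ∀ n : M₂, p • i₂.hom n = 0) (hexact₂ : ∀ m : A₂, p • m = 0 → ∃ n : M₂, i₂.hom n = m)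
    (hdiv₂ : ∀ m : A₂, ∃ m' : A₂, p • m' = m)
    (hinj₃ : Injective i₃.hom) (htors₃ : ∀ n : M₃, p • i₃.hom n = 0) (hexact₃ : ∀ m : A₃, p • m = 0 → ∃ n : M₃, i₃.hom n = m)
    (hdiv₃ : ∀ m : A₃, ∃ m' : A₃, p • m' = m)
    [Subsingleton (continuousCohomology 2 τ₁.toTopRep)] [Subsingleton (continuousCohomology 2 τ₂.toTopRep)]
    [Subsingleton (continuousCohomology 2 τ₃.toTopRep)] [Subsingleton (continuousCohomology 3 ρ₁.toTopRep)] :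
    Nat.card (continuousCohomology 1 ρ₃.toTopRep ⧸ (cohomologyMap g 1).hom.toLinearMap.toAddMonoidHom.range) *
        Nat.card (ModN (continuousCohomology 1 τ₂.toTopRep) p) =
      Nat.card (ModN (continuousCohomology 1 τ₁.toTopRep) p) * Nat.card (ModN (continuousCohomology 1 τ₃.toTopRep) p) := by
  rw [natCard_modN_one_eq_natCard_two i₁ hinj₁ htors₁ hexact₁ hdiv₁,
    natCard_modN_one_eq_natCard_two i₂ hinj₂ htors₂ hexact₂ hdiv₂,
    natCard_modN_one_eq_natCard_two i₃ hinj₃ htors₃ hexact₃ hdiv₃]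
  exact natCard_coker_one_mul_natCard_two h

omit [CompactSpace Γ] in
/-- `H³(Γ, N) = 0` for a discrete `Γ`-module killed by `p` when `cd_p(Γ) ≤ 2`. [cite: SerreGaloisCohomology1997, I §3.1 Prop. 11] -/
theorem subsingleton_three_of_groupCdLE_two {p : ℕ} (hcd : GroupCdLE Γ p 2) (hp : ∀ n : M₁, p • n = 0) :
    Subsingleton (continuousCohomology 3 ρ₁.toTopRep) :=
  hcd M₁ ρ₁ (fun n ↦ ⟨1, by rw [pow_one]; exact hp n⟩) (by norm_num)

/-- **The `H²` bookkeeping with `cd_p(Γ) ≤ 2`** (`GroupCdLE Γ p 2`; for `Γ = Gal(K_Σ/K_∞)` a closed subgroup of `G_{K,Σ}`,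
from the typed fact `DiscreteGaloisModule.groupCdLE_two_galoisGroupUnramifiedOutside` = Harari Cor. 17.14 / NSW (8.3.18) and
`groupCdLE_subgroup_of_isClosed_holds`): as `natCard_H2bookkeeping`, `H³(Γ, N_ω) = 0` being derived from `p · N_ω = 0`.
[cite: KellerYin2024, §1.4 (proof of Thm. 1.4.1 (iii))] [cite: NeukirchSchmidtWingberg2008, (8.3.18)] -/
theorem natCard_H2bookkeeping_of_groupCdLE [LocallyCompactSpace Γ] {f : ρ₁.toTopRep ⟶ ρ₂.toTopRep}
    {g : ρ₂.toTopRep ⟶ ρ₃.toTopRep} (h : IsSES f g) {p : ℕ} (hcd : GroupCdLE Γ p 2) (hp : ∀ n : M₁, p • n = 0)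
    (i₁ : ρ₁.toTopRep ⟶ τ₁.toTopRep) (i₂ : ρ₂.toTopRep ⟶ τ₂.toTopRep) (i₃ : ρ₃.toTopRep ⟶ τ₃.toTopRep)
    (hinj₁ : Injective i₁.hom) (htors₁ : ∀ n : M₁, p • i₁.hom n = 0) (hexact₁ : ∀ m : A₁, p • m = 0 → ∃ n : M₁, i₁.hom n = m)
    (hdiv₁ : ∀ m : A₁, ∃ m' : A₁, p • m' = m)
    (hinj₂ : Injective i₂.hom) (htors₂ : ∀ n : M₂, p • i₂.hom n = 0) (hexact₂ : ∀ m : A₂, p • m = 0 → ∃ n : M₂, i₂.hom n = m)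
    (hdiv₂ : ∀ m : A₂, ∃ m' : A₂, p • m' = m)
    (hinj₃ : Injective i₃.hom) (htors₃ : ∀ n : M₃, p • i₃.hom n = 0) (hexact₃ : ∀ m : A₃, p • m = 0 → ∃ n : M₃, i₃.hom n = m)
    (hdiv₃ : ∀ m : A₃, ∃ m' : A₃, p • m' = m)
    [Subsingleton (continuousCohomology 2 τ₁.toTopRep)] [Subsingleton (continuousCohomology 2 τ₂.toTopRep)]
    [Subsingleton (continuousCohomology 2 τ₃.toTopRep)] :
    Nat.card (continuousCohomology 1 ρ₃.toTopRep ⧸ (cohomologyMap g 1).hom.toLinearMap.toAddMonoidHom.range) *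
        Nat.card (ModN (continuousCohomology 1 τ₂.toTopRep) p) =
      Nat.card (ModN (continuousCohomology 1 τ₁.toTopRep) p) * Nat.card (ModN (continuousCohomology 1 τ₃.toTopRep) p) := by
  haveI := subsingleton_three_of_groupCdLE_two (ρ₁ := ρ₁) hcd hp
  exact natCard_H2bookkeeping h i₁ i₂ i₃ hinj₁ htors₁ hexact₁ hdiv₁ hinj₂ htors₂ hexact₂ hdiv₂ hinj₃ htors₃ hexact₃ hdiv₃

end Cohomology

end Summit.BirchSwinnertonDyer.BirchSwinnertonDyer.Theorems.H2Bookkeeping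

end
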